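import Literature.MathematicalPhysics.QuantumFieldTheory.QCD
import Literature.MathematicalPhysics.QuantumFieldTheory.QCDOS
import Literature.MathematicalPhysics.QuantumFieldTheory.LatticeGaugeProofs
import Literature.MathematicalPhysics.QuantumLattice.GrassmannIntegralWilsonProofs
import HarnessLib

/-!
# The phase-quenched lattice-QCD expectation `⟨·⟩₊` (the `|det|`-reweighted Wilson ensemble)

Definition request `defn-qcdPhaseQuenchedExpect` (route `WilsonMobilityGap` of `QuantumFields/QCD`,
items `MobilityGap` / `PhaseQuenchedFlavourDecay` / `GluonicCompletion`; also inlined, with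
eigenvalue-counting integrands, in route `SpectralDefectExtinction`, and as `∫ · ∂qcdLatticeMeasure`
in route `IntegerCriticalLine`).

## Informal content

With Wilson fermions the `N_f`-flavour fermion determinant `det D(U) = ∏_f det D_W(U, m_f, 1)` is
real (`γ₅`-hermiticity, Montvay–Münster (4.35), (5.16)) but not positive, so Monte-Carlo lattice QCD
samples the POSITIVE weight `P(U) ∝ e^{−β S_W(U)} ∏_f |det D_W(U, m_f)|` (Mohler–Schaefer 2020,
§2.1, "`P(U) ∝ det{D_ud}² |det D_s| e^{−S_g[U]}`") and puts the sign back as a reweighting factor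
`W = det D/|det D| = (−1)^{n_neg}`: `⟨A⟩ = ⟨A W⟩₊ / ⟨W⟩₊`, "with `⟨·⟩₊` the expectation value in the
theory with the modulus of the determinant taken" (ibid. §2.1). This file defines `⟨·⟩₊`:

* `qcdPhaseQuenchedExpect β S mq φ = (∫ |det D(U)| dμ_W)⁻¹ • ∫ |det D(U)| • φ(U) dμ_W(U)`, `μ_W` the
  tree's Wilson probability measure `wilsonMeasure (fundamentalRep (Fin 3)) β` on the four-torus of
  side `S` (tree normalisation `β = 2/g₀²`), `D(U) = diracMatrix U mq` the flavour-diagonal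
  Wilson–Dirac matrix of `QCDOS.lean`; `φ` takes values in any real normed space (`ℝ`, `ℂ`,
  matrix blocks of propagators);
* `qcdDetPhase U mq = det D(U)/|det D(U)|`, the reweighting factor `W` (junk `0` where `det = 0`).

## Proved API

* `det_diracMatrix` (`det D = ∏_f det D_W(m_f)`, block-diagonal), `norm_det_diracMatrix`,
  `det_diracMatrix_im` (`det D ∈ ℝ`); `continuous_wilsonDirac`, `continuous_diracMatrix`,
  measurability and integrability of the weight `U ↦ |det D(U)|`;
* the three inlined forms used by the routes ARE this functional: `qcdPhaseQuenchedExpect_eq_div`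
  (real `φ`, the literal quotient of `WilsonMobilityGap`), `qcdPhaseQuenchedExpect_eq_div_complex`
  (complex `φ`, weight cast to `ℂ`), `qcdPhaseQuenchedExpect_eq_div_prod` (weight `∏_f ‖det D_W‖`,
  `SpectralDefectExtinction`), and `qcdPhaseQuenchedExpect_eq_integral_qcdLatticeMeasure`
  (`⟨φ⟩₊ = ∫ φ ∂(qcdLatticeMeasure S β mq)`, the phase-quenched probability measure of `QCD.lean`);
* normalisation `qcdPhaseQuenchedExpect_const` and positivity of the denominator when `det D ≠ 0`
  `μ_W`-a.e. (`integral_norm_det_diracMatrix_pos`);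
* `qcdPhaseQuenchedExpect_qcdDetPhase`: `⟨W⟩₊ = ∫ det D dμ_W / ∫ |det D| dμ_W`, and
  `norm_qcdPhaseQuenchedExpect_qcdDetPhase`: `‖⟨W⟩₊‖ = ‖∫ det D dμ_W‖ / ∫ |det D| dμ_W` — the
  sign-coherence ratio of `WilsonMobilityGap.MobilityGap` clause (iv).

The reweighting identity `qcdTorusExpect β S mq X = ⟨W ⟨X⟩_F⟩₊ / ⟨W⟩₊` (Gaussian Berezin integral),
the quenched case `N_f = 0` and monotonicity are in the sibling `QCDPhaseQuenchedReweighting.lean`.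

## Design choices / not here

* `S` is the torus SIDE (as for `qcdTorusExpect`); the routes use odd sides `2S+1`.
* General normed-space values with `•` (Mathlib generality, as `wilsonExpectation`); the scalar
  quotient forms are lemmas. Junk: `0` if the denominator vanishes or `|det| • φ` is not integrable.
* Not proved here: that `{U | det D(U) = 0}` is `μ_W`-null (a proper real-algebraic subvariety of
  `SU(3)^{edges}` whenever `det D ≢ 0`); statements needing it carry it as the hypothesis
  `∀ᵐ U ∂μ_W, det D(U) ≠ 0`.
-/

noncomputable section

open MeasureTheory Filter
open scoped ENNReal
open Literature.MathematicalPhysics.QuantumLattice Literature.Probability.LatticeModels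

namespace Literature.MathematicalPhysics.QuantumFieldTheory

/-! ### The Wilson–Dirac matrix as a function of the gauge field -/

section WilsonDirac

variable {L N : ℕ} {G : Type*} [Group G] [TopologicalSpace G] [IsTopologicalGroup G]
  (ρ : G →* Matrix (Fin N) (Fin N) ℂ)

/-- For a continuous representation `ρ` the Wilson–Dirac matrix `D_W(U, m, r)` depends continuously
on the gauge field `U` (its entries are constants plus finite sums of `ρ(U_e)_{ab}`, `ρ(U_e⁻¹)_{ab}`
times fixed spin matrices; Montvay–Münster (4.85), (5.5)). [folklore] -/
theorem continuous_wilsonDirac (hρ : Continuous ρ) (m r : ℝ) :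
    Continuous fun U : GaugeConfig 4 L G => wilsonDirac ρ U m r := by
  refine continuous_pi fun p => continuous_pi fun q => ?_
  simp only [wilsonDirac, Matrix.of_apply]
  refine continuous_const.sub (continuous_const.mul (continuous_finsetSum _ fun μ _ => ?_))
  refine Continuous.add ?_ ?_
  · split_ifs
    · exact continuous_const.mul
        ((hρ.comp (continuous_apply _)).matrix_elem _ _)
    · exact continuous_const
  · split_ifs
    · exact continuous_const.mul
        ((hρ.comp ((continuous_apply _).inv)).matrix_elem _ _)
    · exact continuous_const

end WilsonDirac

variable {Nf : ℕ} {S : ℕ} [NeZero S]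

/-- **`det D(U) = ∏_f det D_W(U, m_f, 1)`**: the `N_f`-flavour Wilson–Dirac matrix is block-diagonal
in flavour, so its determinant is the product of the one-flavour fermion determinants
(Montvay–Münster §5.1.2, effective gauge action `S_eff = −∑_f log det Q_f`). [cite: MontvayMunster1994, §5.1] -/
theorem det_diracMatrix (U : GaugeConfig 4 S SU3) (mq : Fin Nf → ℝ) :
    (diracMatrix U mq).det = ∏ f, fermionDet (wilsonDirac (fundamentalRep (Fin 3)) U (mq f) 1) := by
  have h : (Matrix.of fun v w : QuarkVar Nf S =>
      if v.1 = w.1 then wilsonDirac (fundamentalRep (Fin 3)) U (mq v.1) 1 v.2 w.2 else 0) =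
      Matrix.reindex (Equiv.prodComm _ _) (Equiv.prodComm _ _)
        (Matrix.blockDiagonal fun f => wilsonDirac (fundamentalRep (Fin 3)) U (mq f) 1) := by
    ext ⟨f, i⟩ ⟨g, j⟩
    simp only [Matrix.of_apply, Matrix.reindex_apply, Matrix.submatrix_apply,
      Equiv.prodComm_symm, Equiv.prodComm_apply, Prod.swap_prod_mk, Matrix.blockDiagonal_apply']
  unfold diracMatrix
  rw [Matrix.det_reindex_self, h, Matrix.det_reindex_self, Matrix.det_blockDiagonal]

/-- `|det D(U)| = ∏_f |det D_W(U, m_f, 1)|` — the phase-quenched weight written flavour by flavour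
(the form inlined in route `SpectralDefectExtinction` and in `qcdLatticeWeight`). [cite: MontvayMunster1994, §5.1] -/
theorem norm_det_diracMatrix (U : GaugeConfig 4 S SU3) (mq : Fin Nf → ℝ) :
    ‖(diracMatrix U mq).det‖ = ∏ f, ‖fermionDet (wilsonDirac (fundamentalRep (Fin 3)) U (mq f) 1)‖ := by
  rw [det_diracMatrix, norm_prod]

/-- **The `N_f`-flavour Wilson determinant is real** (`γ₅`-hermiticity flavour by flavour; Montvay–Münster
(5.16) "the quark determinant is real"). [cite: MontvayMunster1994, §5.1.2 (5.16)] -/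
theorem det_diracMatrix_im (U : GaugeConfig 4 S SU3) (mq : Fin Nf → ℝ) :
    ((diracMatrix U mq).det).im = 0 := by
  have h : ∀ f, fermionDet (wilsonDirac (fundamentalRep (Fin 3)) U (mq f) 1) =
      (((fermionDet (wilsonDirac (fundamentalRep (Fin 3)) U (mq f) 1)).re : ℝ) : ℂ) := fun f =>
    Complex.ext (by simp) (by
      simpa using fermionDet_wilsonDirac_im_holds (L := S) (fundamentalRep (Fin 3))
        (fun g => fundamentalRep_mem_unitaryGroup g) U (mq f) 1)
  rw [det_diracMatrix, Finset.prod_congr rfl fun f _ => h f, ← Complex.ofReal_prod, Complex.ofReal_im]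

/-- The real Wilson determinant equals (the cast of) its real part. [folklore] -/
theorem det_diracMatrix_eq_ofReal_re (U : GaugeConfig 4 S SU3) (mq : Fin Nf → ℝ) :
    (diracMatrix U mq).det = (((diracMatrix U mq).det.re : ℝ) : ℂ) :=
  Complex.ext (by simp) (by simp [det_diracMatrix_im])

/-- `|det D(U)| = |Re det D(U)|` (the determinant is real). [folklore] -/
theorem norm_det_diracMatrix_eq_abs_re (U : GaugeConfig 4 S SU3) (mq : Fin Nf → ℝ) :
    ‖(diracMatrix U mq).det‖ = |(diracMatrix U mq).det.re| := by
  rw [det_diracMatrix_eq_ofReal_re, Complex.norm_real, Real.norm_eq_abs, Complex.ofReal_re]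

/-- The flavour-diagonal Wilson–Dirac matrix depends continuously on the gauge field. [folklore] -/
theorem continuous_diracMatrix (mq : Fin Nf → ℝ) :
    Continuous fun U : GaugeConfig 4 S SU3 => diracMatrix U mq := by
  unfold diracMatrix
  refine continuous_pi fun i => continuous_pi fun j => ?_
  simp only [Matrix.reindex_apply, Matrix.submatrix_apply, Matrix.of_apply]
  split_ifs
  · exact ((continuous_wilsonDirac (fundamentalRep (Fin 3)) (continuous_fundamentalRep (Fin 3))
      _ _).matrix_elem _ _)
  · exact continuous_const

/-- `U ↦ det D(U)` is continuous (a polynomial in the link matrix entries). [folklore] -/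
theorem continuous_det_diracMatrix (mq : Fin Nf → ℝ) :
    Continuous fun U : GaugeConfig 4 S SU3 => (diracMatrix U mq).det :=
  (continuous_diracMatrix mq).matrix_det

/-- The phase-quenched weight `U ↦ |det D(U)|` is measurable. [folklore] -/
theorem measurable_norm_det_diracMatrix (mq : Fin Nf → ℝ) :
    Measurable fun U : GaugeConfig 4 S SU3 => ‖(diracMatrix U mq).det‖ :=
  (continuous_det_diracMatrix mq).norm.measurable

/-- The phase-quenched weight is bounded on the (compact) configuration space. [folklore] -/
theorem exists_norm_det_diracMatrix_le (mq : Fin Nf → ℝ) :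
    ∃ C : ℝ, ∀ U : GaugeConfig 4 S SU3, ‖(diracMatrix U mq).det‖ ≤ C := by
  obtain ⟨U₀, -, hU₀⟩ := (isCompact_univ (X := GaugeConfig 4 S SU3)).exists_isMaxOn
    Set.univ_nonempty ((continuous_det_diracMatrix (S := S) mq).norm.continuousOn)
  exact ⟨‖(diracMatrix U₀ mq).det‖, fun U => hU₀ (Set.mem_univ U)⟩

/-- The phase-quenched weight is integrable against every finite measure on configurations (in
particular against the Wilson measure). [folklore] -/
theorem integrable_norm_det_diracMatrix (mq : Fin Nf → ℝ) (μ : Measure (GaugeConfig 4 S SU3))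
    [IsFiniteMeasure μ] : Integrable (fun U => ‖(diracMatrix U mq).det‖) μ := by
  obtain ⟨C, hC⟩ := exists_norm_det_diracMatrix_le (S := S) mq
  exact Integrable.of_bound (measurable_norm_det_diracMatrix mq).aestronglyMeasurable C
    (Eventually.of_forall fun U => by rw [Real.norm_eq_abs, abs_of_nonneg (norm_nonneg _)]; exact hC U)

/-- For the continuous fundamental representation the Wilson partition function of the torus is
neither `0` nor `∞` (read off from `isProbabilityMeasure_wilsonMeasure`). [folklore] -/
theorem partitionFunction_fundamental_ne_zero_and_ne_top (β : ℝ) :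
    partitionFunction (d := 4) (L := S) (fundamentalRep (Fin 3)) β ≠ 0 ∧
      partitionFunction (d := 4) (L := S) (fundamentalRep (Fin 3)) β ≠ ∞ := by
  have h := (isProbabilityMeasure_wilsonMeasure (d := 4) (L := S) (fundamentalRep (Fin 3))
    (continuous_fundamentalRep (Fin 3)) β).measure_univ
  change (partitionFunction (d := 4) (L := S) (fundamentalRep (Fin 3)) β)⁻¹ *
    partitionFunction (d := 4) (L := S) (fundamentalRep (Fin 3)) β = 1 at h
  constructor
  · intro h0; rw [h0] at h; simp at h
  · intro ht; rw [ht] at h; simp at h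

/-- The Wilson measure of `SU(3)` lattice gauge theory on the four-torus is a probability measure
(instance form of the tree's `isProbabilityMeasure_wilsonMeasure`). [folklore] -/
instance isProbabilityMeasure_wilsonMeasure_fundamental (β : ℝ) :
    IsProbabilityMeasure (wilsonMeasure (d := 4) (L := S) (fundamentalRep (Fin 3)) β) :=
  isProbabilityMeasure_wilsonMeasure _ (continuous_fundamentalRep (Fin 3)) β

/-! ### The phase-quenched expectation -/

section Expect

variable {E : Type*} [NormedAddCommGroup E] [NormedSpace ℝ E]

/-- **Phase-quenched lattice-QCD expectation `⟨φ⟩₊`** on the four-torus of side `S` at inverse bare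
coupling `β` (tree normalisation `β = 2/g₀²`) and bare masses `m_f`: the expectation of `φ` under the
POSITIVE weight `e^{−β S_W(U)} ∏_f |det D_W(U, m_f, 1)| ∏_e dU_e`, written as the `|det D|`-reweighted
Wilson expectation `(∫ |det D| dμ_W)⁻¹ • ∫ |det D(U)| • φ(U) dμ_W(U)` with `D = diracMatrix U mq`
(Mohler–Schaefer §2.1: the simulated measure `P(U) ∝ det{D_ud}² |det D_s| e^{−S_g}` and its
expectation `⟨·⟩₊`; Montvay–Münster §5.1.2). Values in any real normed space; junk `0` if the
denominator vanishes or `|det D| • φ` is not `μ_W`-integrable. [cite: MohlerSchaefer2020, §2.1] -/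
def qcdPhaseQuenchedExpect (β : ℝ) (S : ℕ) [NeZero S] (mq : Fin Nf → ℝ)
    (φ : GaugeConfig 4 S SU3 → E) : E :=
  (∫ U, ‖(diracMatrix U mq).det‖ ∂(wilsonMeasure (d := 4) (L := S) (fundamentalRep (Fin 3)) β))⁻¹ •
    ∫ U, ‖(diracMatrix U mq).det‖ • φ U ∂(wilsonMeasure (d := 4) (L := S) (fundamentalRep (Fin 3)) β)

/-- Unfolding `⟨φ⟩₊`. [folklore] -/
theorem qcdPhaseQuenchedExpect_def (β : ℝ) (mq : Fin Nf → ℝ) (φ : GaugeConfig 4 S SU3 → E) :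
    qcdPhaseQuenchedExpect β S mq φ =
      (∫ U, ‖(diracMatrix U mq).det‖ ∂(wilsonMeasure (d := 4) (L := S) (fundamentalRep (Fin 3)) β))⁻¹ •
        ∫ U, ‖(diracMatrix U mq).det‖ • φ U
          ∂(wilsonMeasure (d := 4) (L := S) (fundamentalRep (Fin 3)) β) :=
  rfl

/-- **Real observables**: `⟨φ⟩₊ = ∫ |det D| φ dμ_W / ∫ |det D| dμ_W` — literally the quotient inlined in
route `WilsonMobilityGap` (items `MobilityGap` (ii)–(iii)). [cite: MohlerSchaefer2020, §2.1] -/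
theorem qcdPhaseQuenchedExpect_eq_div (β : ℝ) (mq : Fin Nf → ℝ) (φ : GaugeConfig 4 S SU3 → ℝ) :
    qcdPhaseQuenchedExpect β S mq φ =
      (∫ U, ‖(diracMatrix U mq).det‖ * φ U ∂(wilsonMeasure (d := 4) (L := S) (fundamentalRep (Fin 3)) β)) /
        ∫ U, ‖(diracMatrix U mq).det‖ ∂(wilsonMeasure (d := 4) (L := S) (fundamentalRep (Fin 3)) β) := by
  rw [qcdPhaseQuenchedExpect, smul_eq_mul, inv_mul_eq_div]
  rfl

/-- **Complex observables**: `⟨φ⟩₊ = ∫ (|det D| : ℂ) φ dμ_W / ∫ (|det D| : ℂ) dμ_W` — literally the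
quotient inlined in route `WilsonMobilityGap` (item `PhaseQuenchedFlavourDecay`). [cite: MohlerSchaefer2020, §2.1] -/
theorem qcdPhaseQuenchedExpect_eq_div_complex (β : ℝ) (mq : Fin Nf → ℝ)
    (φ : GaugeConfig 4 S SU3 → ℂ) :
    qcdPhaseQuenchedExpect β S mq φ =
      (∫ U, (‖(diracMatrix U mq).det‖ : ℂ) * φ U
          ∂(wilsonMeasure (d := 4) (L := S) (fundamentalRep (Fin 3)) β)) /
        ∫ U, (‖(diracMatrix U mq).det‖ : ℂ) ∂(wilsonMeasure (d := 4) (L := S) (fundamentalRep (Fin 3)) β) := by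
  rw [integral_complex_ofReal, div_eq_inv_mul, ← Complex.ofReal_inv, qcdPhaseQuenchedExpect,
    Complex.real_smul]
  simp_rw [Complex.real_smul]

/-- **Flavour-product form**: `⟨φ⟩₊ = ∫ φ ∏_f |det D_W(m_f)| dμ_W / ∫ ∏_f |det D_W(m_f)| dμ_W` — the
quotient inlined in route `SpectralDefectExtinction`. [cite: MontvayMunster1994, §5.1] -/
theorem qcdPhaseQuenchedExpect_eq_div_prod (β : ℝ) (mq : Fin Nf → ℝ) (φ : GaugeConfig 4 S SU3 → ℝ) :
    qcdPhaseQuenchedExpect β S mq φ =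
      (∫ U, φ U * ∏ f, ‖fermionDet (wilsonDirac (fundamentalRep (Fin 3)) U (mq f) 1)‖
          ∂(wilsonMeasure (d := 4) (L := S) (fundamentalRep (Fin 3)) β)) /
        ∫ U, ∏ f, ‖fermionDet (wilsonDirac (fundamentalRep (Fin 3)) U (mq f) 1)‖
          ∂(wilsonMeasure (d := 4) (L := S) (fundamentalRep (Fin 3)) β) := by
  rw [qcdPhaseQuenchedExpect_eq_div]
  simp only [norm_det_diracMatrix, mul_comm (φ _)]

/-- **`⟨φ⟩₊` is the expectation under the phase-quenched probability measure** `qcdLatticeMeasure`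
of `QCD.lean` (`Z⁻¹ e^{−β S_W} ∏_f |det D_W(m_f)| ∏ dU`): the normalisations of the Wilson measure
cancel (`0 < Z_W < ∞`) and `|det D| = ∏_f |det D_W(m_f)|`. This is the form used in route
`IntegerCriticalLine`. [cite: MontvayMunster1994, §5.1] -/
theorem qcdPhaseQuenchedExpect_eq_integral_qcdLatticeMeasure (β : ℝ) (mq : Fin Nf → ℝ)
    (φ : GaugeConfig 4 S SU3 → E) :
    qcdPhaseQuenchedExpect β S mq φ = ∫ U, φ U ∂(qcdLatticeMeasure S β mq) := by
  obtain ⟨hZ0, hZT⟩ := partitionFunction_fundamental_ne_zero_and_ne_top (S := S) β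
  have hg0 : ∀ U : GaugeConfig 4 S SU3,
      0 ≤ ∏ f, ‖fermionDet (wilsonDirac (fundamentalRep (Fin 3)) U (mq f) 1)‖ := fun U =>
    Finset.prod_nonneg fun f _ => norm_nonneg _
  have hgm : Measurable fun U : GaugeConfig 4 S SU3 =>
      ∏ f, ‖fermionDet (wilsonDirac (fundamentalRep (Fin 3)) U (mq f) 1)‖ := by
    have := measurable_norm_det_diracMatrix (S := S) mq
    simp_rw [norm_det_diracMatrix] at this
    exact this
  -- the right-hand side
  have hVuniv : qcdLatticeWeight S β mq Set.univ =
      ∫⁻ U, ENNReal.ofReal (∏ f, ‖fermionDet (wilsonDirac (fundamentalRep (Fin 3)) U (mq f) 1)‖)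
        ∂(wilsonWeight (d := 4) (L := S) (fundamentalRep (Fin 3)) β) := by
    rw [qcdLatticeWeight, withDensity_apply _ MeasurableSet.univ, Measure.restrict_univ]
  have hint : ∫ U, ∏ f, ‖fermionDet (wilsonDirac (fundamentalRep (Fin 3)) U (mq f) 1)‖
      ∂(wilsonWeight (d := 4) (L := S) (fundamentalRep (Fin 3)) β) =
      (∫⁻ U, ENNReal.ofReal (∏ f, ‖fermionDet (wilsonDirac (fundamentalRep (Fin 3)) U (mq f) 1)‖)
        ∂(wilsonWeight (d := 4) (L := S) (fundamentalRep (Fin 3)) β)).toReal :=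
    integral_eq_lintegral_of_nonneg_ae (Eventually.of_forall hg0) hgm.aestronglyMeasurable
  rw [qcdLatticeMeasure, integral_smul_measure, hVuniv, qcdLatticeWeight,
    integral_withDensity_eq_integral_toReal_smul hgm.ennreal_ofReal
      (Eventually.of_forall fun _ => ENNReal.ofReal_lt_top),
    ENNReal.toReal_inv, ← hint]
  simp_rw [ENNReal.toReal_ofReal (hg0 _)]
  -- the left-hand side
  rw [qcdPhaseQuenchedExpect]
  simp_rw [norm_det_diracMatrix]
  simp only [wilsonMeasure, integral_smul_measure, smul_eq_mul]
  have hz : ((partitionFunction (d := 4) (L := S) (fundamentalRep (Fin 3)) β)⁻¹).toReal ≠ 0 :=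
    ENNReal.toReal_ne_zero.2 ⟨ENNReal.inv_ne_zero.2 hZT, ENNReal.inv_ne_top.2 hZ0⟩
  rw [smul_smul, mul_comm _ (∫ _, _ ∂_), mul_inv, mul_assoc, inv_mul_cancel₀ hz, mul_one]

/-- **Normalisation**: `⟨c⟩₊ = c` as soon as the denominator `∫ |det D| dμ_W` is nonzero. [folklore] -/
theorem qcdPhaseQuenchedExpect_const [CompleteSpace E] (β : ℝ) (mq : Fin Nf → ℝ)
    (h : ∫ U, ‖(diracMatrix U mq).det‖ ∂(wilsonMeasure (d := 4) (L := S) (fundamentalRep (Fin 3)) β) ≠ 0)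
    (c : E) : qcdPhaseQuenchedExpect β S mq (fun _ => c) = c := by
  rw [qcdPhaseQuenchedExpect, integral_smul_const, smul_smul, inv_mul_cancel₀ h, one_smul]

/-- **Linearity in the observable** (scalars): `⟨a • φ⟩₊ = a • ⟨φ⟩₊`. [folklore] -/
theorem qcdPhaseQuenchedExpect_smul (β : ℝ) (mq : Fin Nf → ℝ) (a : ℝ) (φ : GaugeConfig 4 S SU3 → E) :
    qcdPhaseQuenchedExpect β S mq (fun U => a • φ U) = a • qcdPhaseQuenchedExpect β S mq φ := by
  simp only [qcdPhaseQuenchedExpect]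
  rw [show (fun U => ‖(diracMatrix U mq).det‖ • a • φ U) = fun U => a • ‖(diracMatrix U mq).det‖ • φ U
    from funext fun U => smul_comm _ _ _, integral_smul]
  exact smul_comm _ _ _

/-- **Additivity in the observable** for integrable `|det D| • φ`, `|det D| • ψ`. [folklore] -/
theorem qcdPhaseQuenchedExpect_add (β : ℝ) (mq : Fin Nf → ℝ) (φ ψ : GaugeConfig 4 S SU3 → E)
    (hφ : Integrable (fun U => ‖(diracMatrix U mq).det‖ • φ U)
      (wilsonMeasure (d := 4) (L := S) (fundamentalRep (Fin 3)) β))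
    (hψ : Integrable (fun U => ‖(diracMatrix U mq).det‖ • ψ U)
      (wilsonMeasure (d := 4) (L := S) (fundamentalRep (Fin 3)) β)) :
    qcdPhaseQuenchedExpect β S mq (fun U => φ U + ψ U) =
      qcdPhaseQuenchedExpect β S mq φ + qcdPhaseQuenchedExpect β S mq ψ := by
  simp only [qcdPhaseQuenchedExpect, smul_add, integral_add hφ hψ]

/-- **Positivity of the denominator**: if `det D(U) ≠ 0` for `μ_W`-a.e. `U` then
`0 < ∫ |det D| dμ_W`, so `⟨·⟩₊` is a genuine normalised average. [folklore] -/
theorem integral_norm_det_diracMatrix_pos (β : ℝ) (mq : Fin Nf → ℝ)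
    (h : ∀ᵐ U ∂(wilsonMeasure (d := 4) (L := S) (fundamentalRep (Fin 3)) β), (diracMatrix U mq).det ≠ 0) :
    0 < ∫ U, ‖(diracMatrix U mq).det‖ ∂(wilsonMeasure (d := 4) (L := S) (fundamentalRep (Fin 3)) β) := by
  set μ := wilsonMeasure (d := 4) (L := S) (fundamentalRep (Fin 3)) β with hμ
  rw [integral_pos_iff_support_of_nonneg_ae (Eventually.of_forall fun U => norm_nonneg _)
    (integrable_norm_det_diracMatrix mq μ)]
  rw [pos_iff_ne_zero]
  intro h0
  rw [measure_eq_zero_iff_ae_notMem] at h0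
  have hfalse : ∀ᵐ U ∂μ, False := by
    filter_upwards [h, h0] with U hU hU'
    exact hU' (Function.mem_support.2 (norm_ne_zero_iff.2 hU))
  rw [eventually_false_iff_eq_bot, ae_eq_bot] at hfalse
  exact IsProbabilityMeasure.ne_zero μ hfalse

end Expect

/-! ### The determinant phase (reweighting factor) -/

/-- **The reweighting factor** `W(U) = det D(U)/|det D(U)|` of the signed theory relative to the
phase-quenched one (Mohler–Schaefer §2.1, `W_s = det D_s/|det D_s| = (−1)^{n_neg}`); since `det D`
is real, `W(U) ∈ {±1}` wherever `det D(U) ≠ 0` (junk `0` where `det D(U) = 0`). [cite: MohlerSchaefer2020, §2.1] -/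
def qcdDetPhase (U : GaugeConfig 4 S SU3) (mq : Fin Nf → ℝ) : ℂ :=
  (diracMatrix U mq).det / ‖(diracMatrix U mq).det‖

/-- `|det D| · W = det D` (also where `det D = 0`). [folklore] -/
theorem norm_mul_qcdDetPhase (U : GaugeConfig 4 S SU3) (mq : Fin Nf → ℝ) :
    (‖(diracMatrix U mq).det‖ : ℂ) * qcdDetPhase U mq = (diracMatrix U mq).det := by
  unfold qcdDetPhase
  by_cases h : (diracMatrix U mq).det = 0
  · simp [h]
  · rw [mul_div_cancel₀ _ (by exact_mod_cast norm_ne_zero_iff.2 h)]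

/-- The reweighting factor is the SIGN of the (real) determinant: `W(U) = sgn (Re det D(U))`.
[cite: MohlerSchaefer2020, §2.1] -/
theorem qcdDetPhase_eq_sign (U : GaugeConfig 4 S SU3) (mq : Fin Nf → ℝ) :
    qcdDetPhase U mq = ((SignType.sign ((diracMatrix U mq).det.re) : ℝ) : ℂ) := by
  have hdet := det_diracMatrix_eq_ofReal_re U mq
  have hn := norm_det_diracMatrix_eq_abs_re U mq
  unfold qcdDetPhase
  rw [hn]
  generalize (diracMatrix U mq).det.re = r at hdet ⊢
  rw [hdet, ← Complex.ofReal_div]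
  congr 1
  rcases lt_trichotomy r 0 with h | h | h
  · rw [abs_of_neg h, sign_neg h, SignType.coe_neg_one, div_neg, div_self h.ne]
  · subst h; simp
  · rw [abs_of_pos h, sign_pos h, SignType.coe_one, div_self h.ne']

/-- **`⟨W⟩₊ = ∫ det D dμ_W / ∫ |det D| dμ_W`**: the phase-quenched average of the reweighting factor
is the ratio of the signed to the phase-quenched partition function (Mohler–Schaefer §2.1,
denominator of `⟨A⟩ = ⟨A W⟩₊/⟨W⟩₊`). [cite: MohlerSchaefer2020, §2.1] -/
theorem qcdPhaseQuenchedExpect_qcdDetPhase (β : ℝ) (mq : Fin Nf → ℝ) :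
    qcdPhaseQuenchedExpect β S mq (fun U => qcdDetPhase U mq) =
      (∫ U, (diracMatrix U mq).det ∂(wilsonMeasure (d := 4) (L := S) (fundamentalRep (Fin 3)) β)) /
        ((∫ U, ‖(diracMatrix U mq).det‖
          ∂(wilsonMeasure (d := 4) (L := S) (fundamentalRep (Fin 3)) β) : ℝ) : ℂ) := by
  rw [qcdPhaseQuenchedExpect_eq_div_complex, integral_complex_ofReal]
  simp_rw [norm_mul_qcdDetPhase]

/-- **The sign-coherence ratio**: `‖⟨W⟩₊‖ = ‖∫ det D dμ_W‖ / ∫ |det D| dμ_W` — the quantity bounded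
below by `1/2` in clause (iv) of `WilsonMobilityGap.MobilityGap` is the modulus of the
phase-quenched average sign. [cite: MohlerSchaefer2020, §2.1] -/
theorem norm_qcdPhaseQuenchedExpect_qcdDetPhase (β : ℝ) (mq : Fin Nf → ℝ) :
    ‖qcdPhaseQuenchedExpect β S mq (fun U => qcdDetPhase U mq)‖ =
      ‖∫ U, (diracMatrix U mq).det ∂(wilsonMeasure (d := 4) (L := S) (fundamentalRep (Fin 3)) β)‖ /
        ∫ U, ‖(diracMatrix U mq).det‖ ∂(wilsonMeasure (d := 4) (L := S) (fundamentalRep (Fin 3)) β) := by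
  rw [qcdPhaseQuenchedExpect_qcdDetPhase, norm_div, Complex.norm_real, Real.norm_eq_abs,
    abs_of_nonneg (integral_nonneg fun U => norm_nonneg _)]

end Literature.MathematicalPhysics.QuantumFieldTheory

end
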